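import Summits.FinalStateConjecture.FinalStateConjecture.Theorems.SoloInformedHoleCount

/-!
# SoloInformed — achronal certified slabs: the one-line repair of the covering clause

Soloist `solo-FinalStateConjecture-informed` (session 30, 2026-08-19). Companion to
`SoloInformedDust.lean` / `SoloInformedExhaustive.lean` (paper/EXHAUST.md §4–§5).

Clause (ii) of the typed SETTLING clause `HasExhaustiveCharts` —
`O ∖ certifiedLate d R τ₁ ⊆ J⁻(certifiedSlab d R τ₁)` for every chart time `τ₁ > τ₀` — certifies
exactly as much of `O` as the REACH of the certified slabs allows (`SoloInformedExhaustive.lean`):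
it is vacuous for witnesses whose certified slab at each label has all of `O` in its causal past
("dust", `SoloInformedDust.lean`; "boosted tentacles", paper/EXHAUST.md §4), because the typed flat
domain `U₀ : Opens E4` and the flat chart on its non-mandated part are free.

**The repair studied here (F-q): require every certified slab to be ACHRONAL** — as a leaf of a
time function is. Its payoff is a theorem of pure causality theory, with no time function and no
bounded-reach hypothesis:

* `causalPast_inter_chronologicalFuture_eq_empty_of_isAchronal`: for an achronal set `S` of a
  spacetime, `J⁻(S) ∩ I⁺(S) = ∅` (if `a ≪ p ≤ a'` with `a, a' ∈ S` then `a ≪ a'` by push-up,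
  O'Neill 1983, Cor. 14.1 — contradicting achronality).
* `inter_chronologicalFuture_subset_certifiedLate`: hence clause (ii) at `τ₁` with an achronal
  certified slab forces `O ∩ I⁺(certifiedSlab d R τ₁) ⊆ certifiedLate d R τ₁` — EVERY event of `O`
  in the chronological future of the certified slab is certified-late at `τ₁` (in the flat chart's
  late image or in a hole chart's near zone). On the intended strata `I⁺` of the honest far slab
  `{t ≈ τ₁, r > ρ(τ₁)}` contains every event of the domain of outer communications with advanced
  time `v > τ₁ + ρ(τ₁) + C` (paper/EXHAUST.md §5), so this is the full audit-g6 reading of the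
  clause ("no annulus, no late part of `O` uncertified"), and dust / tentacle / spike witnesses are
  excluded (their late images are chronologically preceded by the honest part of the same slab).
* `HasAchronalExhaustiveCharts`: the repaired clause (the typed one plus achronality of the
  certified slabs); it implies the typed clause (`HasAchronalExhaustiveCharts.hasExhaustiveCharts`)
  and the certification statement (`HasAchronalExhaustiveCharts.exists_certified`).

References: [DafermosLuk2017] M. Dafermos, J. Luk, arXiv:1710.01722, Conjecture 1 (b)–(c);
O'Neill 1983, Ch. 14, Cor. 14.1 (p. 402), p. 403 (time duality), p. 413 (achronal sets);
Hawking–Ellis 1973, §6.2–§6.3.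
-/

open Literature.Geometry.Lorentzian
open scoped Manifold ContDiff Topology
open Filter Set

set_option linter.dupNamespace false

namespace Summit.FinalStateConjecture.FinalStateConjecture.Theorems

section Achronal

variable {𝓢 : Spacetime.{0} 4} {O : Set 𝓢.carrier} {k : ℕ}

/-- **An achronal set is not entered from its own chronological future: `J⁻(S) ∩ I⁺(S) = ∅`.**
If `p ∈ I⁺(a)` and `p ∈ J⁻(a')` with `a, a' ∈ S`, then `a ≪ p ≤ a'`, so `a ≪ a'` by push-up
(O'Neill 1983, Ch. 14, Cor. 14.1, applied to the reversed time orientation) — contradicting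
achronality of `S`. O'Neill 1983, Ch. 14, p. 413 with Cor. 14.1 (p. 402).
[cite: ONeill1983, Ch. 14  p. 413] -/
theorem causalPast_inter_chronologicalFuture_eq_empty_of_isAchronal {S : Set 𝓢.carrier}
    (hS : 𝓢.metric.IsAchronal 𝓢.timeOrientation S) :
    𝓢.metric.causalPast 𝓢.timeOrientation S ∩
      𝓢.metric.chronologicalFuture 𝓢.timeOrientation S = ∅ := by
  have hn : (1 : ℕ∞ω) ≤ ∞ := WithTop.coe_le_coe.mpr le_top
  refine eq_empty_iff_forall_notMem.2 fun p hp ↦ ?_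
  obtain ⟨hpJ, hpI⟩ := hp
  rw [LorentzianMetric.chronologicalFuture_eq_biUnion] at hpI
  rw [LorentzianMetric.causalPast, LorentzianMetric.causalFuture_eq_biUnion] at hpJ
  simp only [mem_iUnion, exists_prop] at hpI hpJ
  obtain ⟨a, ha, hpa⟩ := hpI
  obtain ⟨a', ha', hpa'⟩ := hpJ
  -- `a ≪ p` read in the reversed orientation: `a ∈ I⁻(p) = I⁺_rev(p)`
  have hap : a ∈ 𝓢.metric.chronologicalFuture 𝓢.timeOrientation.reverse {p} :=
    LorentzianMetric.mem_chronologicalPast_of_mem_chronologicalFuture hpa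
  -- push-up in the reversed orientation: `p ∈ J⁺_rev(a')`, `a ∈ I⁺_rev(p)` ⟹ `a ∈ I⁺_rev(a')`
  have haa' : a ∈ 𝓢.metric.chronologicalPast 𝓢.timeOrientation {a'} :=
    LorentzianMetric.mem_chronologicalFuture_of_mem_causalFuture hn hpa' hap
  exact hS a ha a' ha' (LorentzianMetric.mem_chronologicalFuture_of_mem_chronologicalPast haa')

/-- Equivalent subset form: the causal past of an achronal set misses its chronological future.
[cite: ONeill1983, Ch. 14  p. 413] -/
theorem disjoint_causalPast_chronologicalFuture_of_isAchronal {S : Set 𝓢.carrier}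
    (hS : 𝓢.metric.IsAchronal 𝓢.timeOrientation S) :
    Disjoint (𝓢.metric.causalPast 𝓢.timeOrientation S)
      (𝓢.metric.chronologicalFuture 𝓢.timeOrientation S) :=
  disjoint_iff_inter_eq_empty.2 (causalPast_inter_chronologicalFuture_eq_empty_of_isAchronal hS)

/-- **Achronal certified slab ⇒ its chronological future in `O` is certified.** If clause (ii) of
`HasExhaustiveCharts` holds at `τ₁` for the radii `R` and the certified slab at `τ₁` is achronal,
then every event of `O` in the chronological future of the certified slab is certified-late at
`τ₁` (in the flat chart's late image `{x⁰ > τ₁}` or in a hole chart's near zone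
`{t*ᵢ > τ₁, rᵢ ≤ Rᵢ(t*ᵢ)}`). No time function and no bounded-reach hypothesis is needed.
[cite: DafermosLuk2017, Conjecture 1 (b)–(c)] -/
theorem inter_chronologicalFuture_subset_certifiedLate (d : FinalStateDecomposition 𝓢 O k)
    (R : Fin d.N → ℝ → ℝ) {τ₁ : ℝ}
    (hii : O \ Summit.FinalStateConjecture.certifiedLate d R τ₁ ⊆
      𝓢.metric.causalPast 𝓢.timeOrientation (Summit.FinalStateConjecture.certifiedSlab d R τ₁))
    (hS : 𝓢.metric.IsAchronal 𝓢.timeOrientation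
      (Summit.FinalStateConjecture.certifiedSlab d R τ₁)) :
    O ∩ 𝓢.metric.chronologicalFuture 𝓢.timeOrientation
        (Summit.FinalStateConjecture.certifiedSlab d R τ₁) ⊆
      Summit.FinalStateConjecture.certifiedLate d R τ₁ := by
  rintro p ⟨hpO, hpI⟩
  by_contra hpl
  have h := causalPast_inter_chronologicalFuture_eq_empty_of_isAchronal hS
  exact (eq_empty_iff_forall_notMem.1 h) p ⟨hii ⟨hpO, hpl⟩, hpI⟩

/-- Contrapositive form: under clause (ii) at `τ₁` with an achronal certified slab, an event of `O`
that is NOT certified-late at `τ₁` is not in the chronological future of the certified slab.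
[cite: DafermosLuk2017, Conjecture 1 (b)–(c)] -/
theorem not_mem_chronologicalFuture_of_not_mem_certifiedLate (d : FinalStateDecomposition 𝓢 O k)
    (R : Fin d.N → ℝ → ℝ) {τ₁ : ℝ}
    (hii : O \ Summit.FinalStateConjecture.certifiedLate d R τ₁ ⊆
      𝓢.metric.causalPast 𝓢.timeOrientation (Summit.FinalStateConjecture.certifiedSlab d R τ₁))
    (hS : 𝓢.metric.IsAchronal 𝓢.timeOrientation
      (Summit.FinalStateConjecture.certifiedSlab d R τ₁)) {p : 𝓢.carrier} (hpO : p ∈ O)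
    (hpl : p ∉ Summit.FinalStateConjecture.certifiedLate d R τ₁) :
    p ∉ 𝓢.metric.chronologicalFuture 𝓢.timeOrientation
      (Summit.FinalStateConjecture.certifiedSlab d R τ₁) :=
  fun hpI ↦ hpl (inter_chronologicalFuture_subset_certifiedLate d R hii hS ⟨hpO, hpI⟩)

/-- **The repaired covering clause (F-q): exhaustive charts with ACHRONAL certified slabs.** The
typed `HasExhaustiveCharts d` with, for the same radii, every certified slab `certifiedSlab d R τ₁`
(`τ₁ > τ₀`) achronal — as it is in the intended witnesses, where chart times are induced by one
time function of the development. [cite: DafermosLuk2017, Conjecture 1 (b)–(c)] -/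
def HasAchronalExhaustiveCharts (d : FinalStateDecomposition 𝓢 O k) : Prop :=
  ∃ R : Fin d.N → ℝ → ℝ,
    (∀ i, Tendsto (R i) atTop atTop ∧ ∀ τ, max (Kerr.rPlus (d.mass i) (d.spin i)) 0 + 1 ≤ R i τ) ∧
    (∀ i, Tendsto (fun τ ↦ 𝓢.truncDeviationCk (d.background i) (d.chart i) k (R i τ) τ)
      atTop (𝓝 0)) ∧
    (∀ τ₁ : ℝ, d.τ₀ < τ₁ →
      𝓢.metric.IsAchronal 𝓢.timeOrientation (Summit.FinalStateConjecture.certifiedSlab d R τ₁)) ∧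
    ∀ τ₁ : ℝ, d.τ₀ < τ₁ →
      O \ Summit.FinalStateConjecture.certifiedLate d R τ₁ ⊆
        𝓢.metric.causalPast 𝓢.timeOrientation (Summit.FinalStateConjecture.certifiedSlab d R τ₁)

/-- The repaired clause implies the typed one (drop achronality). [folklore] -/
theorem HasAchronalExhaustiveCharts.hasExhaustiveCharts (d : FinalStateDecomposition 𝓢 O k)
    (h : HasAchronalExhaustiveCharts d) : Summit.FinalStateConjecture.HasExhaustiveCharts d := by
  obtain ⟨R, hR, hdev, -, hii⟩ := h
  exact ⟨R, hR, hdev, hii⟩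

/-- **Payoff of the repair.** Under the repaired clause there are near-zone radii `Rᵢ → ∞` (the
witness's) such that, for every chart time `τ₁ > τ₀`, every event of `O` in the chronological future
of the certified slab at `τ₁` is certified-late at `τ₁`: the charts leave no late part of `O`
uncertified, and no uncertified annulus between a near zone and the radiation zone survives into
`I⁺` of any certified slab. [cite: DafermosLuk2017, Conjecture 1 (b)–(c)] -/
theorem HasAchronalExhaustiveCharts.exists_certified (d : FinalStateDecomposition 𝓢 O k)
    (h : HasAchronalExhaustiveCharts d) :
    ∃ R : Fin d.N → ℝ → ℝ, (∀ i, Tendsto (R i) atTop atTop) ∧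
      ∀ τ₁ : ℝ, d.τ₀ < τ₁ →
        O ∩ 𝓢.metric.chronologicalFuture 𝓢.timeOrientation
            (Summit.FinalStateConjecture.certifiedSlab d R τ₁) ⊆
          Summit.FinalStateConjecture.certifiedLate d R τ₁ := by
  obtain ⟨R, hR, -, hach, hii⟩ := h
  exact ⟨R, fun i ↦ (hR i).1, fun τ₁ hτ ↦
    inter_chronologicalFuture_subset_certifiedLate d R (hii τ₁ hτ) (hach τ₁ hτ)⟩

/-- **Why achronality excludes dust.** If the certified slab at `τ₁` contains two chronologically
related events — e.g. a point of the honest far slab and a later "dust" image in its chronological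
future — it is not achronal. (Restatement of the definition, recorded as the form in which the
dust, tentacle and spike witnesses of paper/CAPS.md §3, §9 and paper/EXHAUST.md §4 fail F-q.)
[cite: ONeill1983, Ch. 14  p. 413] -/
theorem not_isAchronal_of_mem_chronologicalFuture {S : Set 𝓢.carrier} {a b : 𝓢.carrier}
    (ha : a ∈ S) (hb : b ∈ S) (hab : b ∈ 𝓢.metric.chronologicalFuture 𝓢.timeOrientation {a}) :
    ¬ 𝓢.metric.IsAchronal 𝓢.timeOrientation S :=
  fun hS ↦ hS a ha b hb hab

end Achronal

end Summit.FinalStateConjecture.FinalStateConjecture.Theorems
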